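import Summits.Ventures.WeilGRH.UniformConductorFloorJointDataLog12
import HarnessLib

/-!
# GRH arm (rh-explicit, venture WeilGRH): kernel check of the EVEN joint cell certificate `certEvenLog12` at `(log 12)/2` — part B

Cell `rh-explicit`, WEIL TRACK — GRH ARM (weil-grh-1, gen9).  The cells `[199, 398)` of `certEvenLog12`
(`UniformConductorFloorJointDataLog12.lean`) by `decide +kernel` (integer arithmetic only; one range per file).  Glued in `UniformConductorFloorJointFloorsLog12.lean` by
`JointCert.cellsLoop_spec`.  No definitions; no named facts; standard axioms. [folklore]
-/

namespace Summit.Ventures.WeilGRH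

namespace UniformFloor

set_option maxHeartbeats 0 in
set_option maxRecDepth 100000 in
/-- Cells `[199, 398)` of `certEvenLog12`. [folklore] -/
theorem certEvenLog12_cellsB : certEvenLog12.cellsRange 199 199 = true := by
  decide +kernel

end UniformFloor

end Summit.Ventures.WeilGRH
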